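import Summits.NavierStokesRegularity.NavierStokesRegularity.Theorems.QuietScarPocketDoorDoor

/-!
# QuietScarPocketDoorLPocketDefs — door S31 «QuietScarPocketDoor», §B «L-POCKET SCHEMA»: texts of record + kernel-checked
# compositions (plate P0_L)

Texts of record: nsreg-p1 g25 `r29/Sketch31D.lean` sha16 8bb56c0a84466268 (2026-08-28T11:05:54Z), landed VERBATIM (every
declaration below is byte-identical to the sketch; only this landing paragraph and seven missing docstrings are added) by ns-imp-p1 g4 as first plate hand
of the S-door lane (DIRECTOR-NS #209 (2)), `--supports stmt-NavierStokesRegularity-0056 --as helper`.  The open statements are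
`def … : Prop` texts (no proof placeholders); the plates (P1) `lPocketZoom_holds`, (P2) `terminalTraceAnalyticVelocity_holds`,
(P3) `frameTransferL_holds`, (P4)–(P6) the three rigidities land in their own `Theorems/QuietScarPocketDoorL*.lean` files.
WHAT THIS IS NOT: a corollary SCHEMA of the S31 criterion about HYPOTHETICAL one-point Type-I blow-up profiles; item 0056
`NoTypeII` and NS regularity are NOT proved; nothing here is a route or a summit statement.

## The sketch's own header (nsreg-p1 g25), verbatim

Sketch31D — §B of ROUND-29: the L-POCKET SCHEMA (door S31 as the instance `L = curlCLM` of a door schema)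

nsreg-p1 g25, 2026-08-28 (cell sketch, farm-checked, NOT proposed; ADDITIVE — the sealed texts
`Sketch31.lean` v2.1 363b5766493b6c28 = tree `Theorems/QuietScarPocketDoorDefs.lean` are untouched; S31 itself is
CLOSED BY NAME, `targetScarPocket_holds` p627032).  B-SHEET (corollary schema), not a memo.

THE SCHEMA.  Fix a continuous linear CONSTRAINT `L : (E³ →L[ℝ] E³) →L[ℝ] F` on velocity gradients (any real normed
space `F`).  DOOR_L: at a one-point Type-I point `(x₀,T)`, ONE pocket `B(x₁, κ‖x₁−x₀‖)` on which the blow-up-time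
velocity gradient is `ε`-ANNIHILATED BY `L` at the critical rate — `‖x₁−x₀‖² ‖L(∇u(t,x))‖ ≤ νε` eventually as `t ↑ T`,
per point — excludes the singularity.  S31 is DOOR_curl (`L = curlCLM`, by `rfl`: `targetLPocketAt_curlCLM`).

WHY IT HOLDS (same chain as S31, one new STATIC input per `L`):  K1_L zoom (PK1 verbatim with top-GRADIENT convergence,
available from LEG F's `TerminalTraceC1`) ⇒ a Type-I ancient limit whose terminal velocity trace `V₀` is real-analytic on
`ℝ³∖{0}` (LEG F, velocity form, tree `terminalSliceVelocityAnalyticity_holds`) with `L(∇V₀) = 0` on a pocket ⇒ (identity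
theorem on the connected `ℝ³∖{0}`, PROVED here: `LConstraint_spread`) `L(∇V₀) ≡ 0` off the apex ⇒ STATIC RIGIDITY
`StaticLRigidity L` («an analytic, divergence-free field on `ℝ³∖{0}` with Type-I decay `|V| ≤ C/|y|`, `|∇V| ≤ C/|y|²`
annihilated by `L` is IRROTATIONAL») ⇒ `curl V₀ ≡ 0` off the apex ⇒ S31's K2 `tracelessScarLiouville_holds` ⇒ contradiction.

INSTANCES (static rigidity inputs; elementary, M-size each — NOT proved here except `curlCLM`):
* `L = curlCLM` (S31): rigidity trivial (PROVED: `staticLRigidity_curlCLM`).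
* `L = strainCLM` («STRAIN-QUIET pocket»: `∇u + ∇uᵀ` small): Killing fields on a connected open set are affine
  `a + b × y`; decay ⇒ `V ≡ 0`.  Reading: a Type-I blow-up STRAINS every pocket at the blow-up time.
* `L = planarCLM e` («PLANAR pocket»: `∂ₑu` small): `V` constant along `e`-lines avoiding `0`, decay ⇒ `V ≡ 0` off the
  axis ⇒ `curl V ≡ 0`.  Reading: a Type-I blow-up is nowhere locally 2D at the blow-up time.
* `L = combCLM e` («COMBED pocket»: `ω − ⟪ω,e⟫e` small, vorticity DIRECTION ε-parallel to `e` where it is Type-I-sized):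
  `ω = f e`, `div ω = 0` ⇒ `∂ₑ f = 0`, gradient decay ⇒ `f ≡ 0`.  Reading (Constantin–Fefferman / Giga–Miura theme, ONE time
  slice, pockets): a Type-I blow-up TWISTS the vorticity direction in every pocket at the blow-up time.  [Giga–Miura 2011
  CMP 303 use space-time uniform continuity of the direction + the KNSS 2D Liouville theorem; here: one slice, elementary.]

PLATES for a prover lane (per instance ≈ PK1-twin (M: F5's last step with `TopGradTendsto`; F1–F4 by name) + PLℓ (S) +
rigidity (S/M) + frame transfer (S, PT verbatim)).  Honest frame: COROLLARY SCHEMA of S31 (ROUND-29 §9 already books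
direction/∇Ω pocket doors as B-sheet); criterion on hypothetical Type-I profiles; 0056 / NS regularity NOT proved.
-/

noncomputable section

open MeasureTheory Set Function Filter Topology TopologicalSpace Metric
open scoped RealInnerProductSpace Topology
open Literature.Analysis Literature.Analysis.FluidPDE

set_option linter.dupNamespace false

namespace Summit.NavierStokesRegularity.NavierStokesRegularity.Theorems.QuietScarPocketDoor

local notation "E³" => EuclideanSpace ℝ (Fin 3)
local notation "𝕊" => Literature.Analysis.FluidPDE.slab (EuclideanSpace ℝ (Fin 3)) (Set.Iio (0 : ℝ)) isOpen_Iio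

variable {F : Type*} [NormedAddCommGroup F] [NormedSpace ℝ F]

/-! ## Part A — the schema texts -/

/-- **DOOR_L in the Pineau–Vicol frame at `(Cu, κ)`** (= `PVScarPocketRegularityAt` with the pocket quantity
`‖curl (u t) x‖` replaced by `‖L (fderiv ℝ (u t) x)‖`). -/
def PVLPocketRegularityAt (L : (E³ →L[ℝ] E³) →L[ℝ] F) (Cu κ : ℝ) : Prop :=
  ∃ ε : ℝ, 0 < ε ∧ ∀ Cp : ℝ, 0 < Cp → ∃ r₁ : ℝ, 0 < r₁ ∧
    ∀ (u : ℝ → E³ → E³) (p : ℝ → E³ → ℝ),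
      IsClassicalNSSolutionOnRegion (Ico (-1 : ℝ) 0 ×ˢ ball (0 : E³) 1) 1 0 u p →
      (∀ t ∈ Ico (-1 : ℝ) 0, ∀ x ∈ ball (0 : E³) 1, ‖u t x‖ ≤ Cu / (Real.sqrt (-t) + ‖x‖)) →
      (∀ t ∈ Ico (-1 : ℝ) 0, ∀ x : E³, 1 / 2 < ‖x‖ → ‖x‖ < 3 / 4 → |p t x| ≤ Cp) →
      (∃ x₁ : E³, 0 < ‖x₁‖ ∧ ‖x₁‖ ≤ r₁ ∧
        ∀ x ∈ ball x₁ (κ * ‖x₁‖), ∀ᶠ t in 𝓝[<] (0 : ℝ), ‖x₁‖ ^ 2 * ‖L (fderiv ℝ (u t) x)‖ ≤ ε) →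
      ∃ ϱ : ℝ, 0 < ϱ ∧ ∃ B : ℝ, ∀ t : ℝ, -ϱ ^ 2 < t → t < 0 → ∀ x ∈ ball (0 : E³) ϱ, ‖u t x‖ ≤ B

/-- **DOOR_L (PV frame):** every Type-I constant, every aperture. -/
def PVLPocketRegularity (L : (E³ →L[ℝ] E³) →L[ℝ] F) : Prop :=
  ∀ Cu : ℝ, 0 < Cu → ∀ κ : ℝ, 0 < κ → κ < 1 → PVLPocketRegularityAt L Cu κ

/-- **DOOR_L at `(ν, M, κ)` in the physical frame** (= `TargetScarPocketAt` with `‖curl (u t) x‖ ↦ ‖L (fderiv ℝ (u t) x)‖`). -/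
def TargetLPocketAt (L : (E³ →L[ℝ] E³) →L[ℝ] F) (ν M κ : ℝ) : Prop :=
  ∃ ε : ℝ, 0 < ε ∧ ∀ (T ρ E₀ : ℝ), 0 < T → 0 < ρ → ∃ r₁ : ℝ, 0 < r₁ ∧
    ∀ (u : ℝ → E³ → E³) (p : ℝ → E³ → ℝ),
    IsClassicalNSSolutionOn (Set.Ico 0 T) ν 0 u p → IsLerayHopfOn T ν 0 (u 0) u → HasRapidSpatialDecay (u 0) →
    VectorCalculus.kineticEnergy (u 0) ≤ E₀ →
    ∀ (x₀ : E³),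
    (∀ t ∈ Set.Ico 0 T, T - ρ ^ 2 < t → ∀ x ∈ ball x₀ ρ, ‖u t x‖ * (‖x - x₀‖ + Real.sqrt (ν * (T - t))) ≤ M) →
    (∃ x₁ : E³, 0 < ‖x₁ - x₀‖ ∧ ‖x₁ - x₀‖ ≤ r₁ ∧
      ∀ x ∈ ball x₁ (κ * ‖x₁ - x₀‖), ∀ᶠ t in 𝓝[<] T, ‖x₁ - x₀‖ ^ 2 * ‖L (fderiv ℝ (u t) x)‖ ≤ ν * ε) →
    IsBackwardBoundedAt u T x₀

/-- **DOOR_L (physical frame):** every viscosity, Type-I constant, aperture. -/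
def TargetLPocket (L : (E³ →L[ℝ] E³) →L[ℝ] F) : Prop :=
  ∀ (ν : ℝ), 0 < ν → ∀ (M κ : ℝ), 0 < κ → κ < 1 → TargetLPocketAt L ν M κ

/-- Frame transfer for DOOR_L (support, S; `FrameTransferS31` verbatim — the pocket quantity is a fixed linear image of
`∇u`, hence scale/translation/viscosity-covariant exactly like the curl). -/
def FrameTransferL (L : (E³ →L[ℝ] E³) →L[ℝ] F) : Prop := PVLPocketRegularity L → TargetLPocket L

/-- S31 is the instance `L = curlCLM`, definitionally. -/
theorem targetLPocketAt_curlCLM (ν M κ : ℝ) : TargetLPocketAt curlCLM ν M κ ↔ TargetScarPocketAt ν M κ := Iff.rfl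

/-- S31 is the instance `L = curlCLM` in the Pineau–Vicol frame, definitionally. -/
theorem pvLPocketRegularityAt_curlCLM (Cu κ : ℝ) :
    PVLPocketRegularityAt curlCLM Cu κ ↔ PVScarPocketRegularityAt Cu κ := Iff.rfl

/-- **Top-GRADIENT convergence** of the continuous representative to a terminal velocity trace `V₀`, locally uniformly
off the apex (the velocity/gradient twin of `TopCurlTendsto`; supplied by LEG F's `TerminalTraceC1` on the limit). -/
def TopGradTendsto (Uc : ℝ → E³ → E³) (V₀ : E³ → E³) : Prop :=
  ∀ x₁ : E³, x₁ ≠ 0 → ∀ θ : ℝ, 0 < θ → ∃ s₀ δ : ℝ, s₀ < 0 ∧ (-1 : ℝ) ≤ s₀ ∧ 0 < δ ∧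
    ∀ s ∈ Ioo s₀ 0, ∀ x ∈ ball x₁ δ, ‖Uc s x - V₀ x‖ ≤ θ ∧ ‖fderiv ℝ (Uc s) x - fderiv ℝ V₀ x‖ ≤ θ

/-- **K1_L — the zoom twin (PK1 with top-gradient convergence; M given S31's F1–F4 by name).**  Negating DOOR_L at
`(Cu,κ)`: critical-rate rescaling about the pocket centres and the zoom engine give a Type-I ancient mild limit, backward
singular at `(0,0)`, with a continuous representative classical off the apex, whose velocity and gradient converge at the
top, locally uniformly off the apex, to a terminal trace `V₀` with Type-I decay, divergence-free, and ANNIHILATED BY `L` on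
the limit pocket `B(e,κ)`, `‖e‖ = 1`. -/
def LPocketZoom (L : (E³ →L[ℝ] E³) →L[ℝ] F) : Prop :=
  ∀ Cu : ℝ, 0 < Cu → ∀ κ : ℝ, 0 < κ → κ < 1 → ¬ PVLPocketRegularityAt L Cu κ →
    ∃ (w : ℝ → E³ → E³) (π : ℝ → E³ → ℝ) (H : ℝ → E³ → E³ →L[ℝ] E³) (C : ℝ) (e : E³)
      (Uc : ℝ → E³ → E³) (V₀ : E³ → E³),
      IsSuitableWeakSolutionOn 𝕊 1 0 w π ∧ HasWeakSpatialGradientOn 𝕊 w H ∧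
      typeIBound (Iio (0 : ℝ) ×ˢ univ) w π H < ⊤ ∧
      (∀ᵐ z ∂(volume.restrict (Iio (0 : ℝ) ×ˢ (univ : Set E³))), ‖w z.1 z.2‖ ≤ C / (‖z.2‖ + Real.sqrt (-z.1))) ∧
      ‖e‖ = 1 ∧ IsBackwardSingularPoint w 0 ∧
      uncurry Uc =ᵐ[volume.restrict (Ioo (-1 : ℝ) 0 ×ˢ ({0}ᶜ : Set E³))] uncurry w ∧
      ContinuousOn (uncurry Uc) (Ioo (-1 : ℝ) 0 ×ˢ ({0}ᶜ : Set E³)) ∧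
      OffApexClassical C Uc ∧ TopGradTendsto Uc V₀ ∧
      (∀ y : E³, y ≠ 0 → ‖V₀ y‖ ≤ C / ‖y‖) ∧
      (∃ C' : ℝ, ∀ y : E³, y ≠ 0 → ‖fderiv ℝ V₀ y‖ ≤ C' / ‖y‖ ^ 2) ∧
      (∀ y : E³, y ≠ 0 → LinearMap.trace ℝ E³ (fderiv ℝ V₀ y).toLinearMap = 0) ∧
      (∀ y ∈ ball e κ, L (fderiv ℝ V₀ y) = 0)

/-- **LEG F at the limit, velocity form (PLℓ, S from the tree's `terminalSliceVelocityAnalyticity_holds`):** whatever the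
velocity/gradient converge to at the top, off the apex, is real-analytic on `ℝ³∖{0}`. -/
def TerminalTraceAnalyticVelocity : Prop :=
  ∀ (C : ℝ) (Uc : ℝ → E³ → E³) (V₀ : E³ → E³),
    OffApexClassical C Uc → TopGradTendsto Uc V₀ → AnalyticOnNhd ℝ V₀ ({0}ᶜ : Set E³)

/-- **STATIC RIGIDITY INPUT for the constraint `L` (K2_L; the only new mathematics per instance):** a real-analytic,
divergence-free field on `ℝ³∖{0}` with Type-I decay of itself and of its gradient, annihilated by `L` everywhere off the
apex, is irrotational off the apex. -/
def StaticLRigidity (L : (E³ →L[ℝ] E³) →L[ℝ] F) : Prop :=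
  ∀ (V : E³ → E³), AnalyticOnNhd ℝ V ({0}ᶜ : Set E³) →
    (∃ C : ℝ, ∀ y : E³, y ≠ 0 → ‖V y‖ ≤ C / ‖y‖) →
    (∃ C : ℝ, ∀ y : E³, y ≠ 0 → ‖fderiv ℝ V y‖ ≤ C / ‖y‖ ^ 2) →
    (∀ y : E³, y ≠ 0 → LinearMap.trace ℝ E³ (fderiv ℝ V y).toLinearMap = 0) →
    (∀ y : E³, y ≠ 0 → L (fderiv ℝ V y) = 0) →
    ∀ y : E³, y ≠ 0 → curl V y = 0

/-- **THE SCHEMA (PV frame):** for every constraint with static rigidity, DOOR_L holds. -/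
def LPocketSchema : Prop :=
  ∀ (F : Type) [NormedAddCommGroup F] [NormedSpace ℝ F] (L : (E³ →L[ℝ] E³) →L[ℝ] F),
    StaticLRigidity L → PVLPocketRegularity L

/-! ## Part B — instances of the constraint -/

/-- «PLANAR pocket»: `L(A) = A e` (the directional derivative `∂ₑ`). -/
def planarCLM (e : E³) : (E³ →L[ℝ] E³) →L[ℝ] E³ := ContinuousLinearMap.apply ℝ E³ e

/-- «COMBED pocket»: `L(A) = curl A − ⟪curl A, e⟫ e` (the part of the vorticity orthogonal to `e`, `‖e‖ = 1`). -/
def combCLM (e : E³) : (E³ →L[ℝ] E³) →L[ℝ] E³ :=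
  (ContinuousLinearMap.id ℝ E³ - (innerSL ℝ e).smulRight e).comp curlCLM

/-- «STRAIN-QUIET pocket»: `L(A)ᵢⱼ = ⟪A eᵢ, eⱼ⟫ + ⟪eᵢ, A eⱼ⟫` (the entries of `A + Aᵀ`, twice the strain). -/
def strainCLM : (E³ →L[ℝ] E³) →L[ℝ] (Fin 3 → Fin 3 → ℝ) :=
  ContinuousLinearMap.pi fun i => ContinuousLinearMap.pi fun j =>
    (innerSL ℝ (EuclideanSpace.single j (1 : ℝ))).comp (ContinuousLinearMap.apply ℝ E³ (EuclideanSpace.single i (1 : ℝ))) +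
    (innerSL ℝ (EuclideanSpace.single i (1 : ℝ))).comp (ContinuousLinearMap.apply ℝ E³ (EuclideanSpace.single j (1 : ℝ)))

/-- `planarCLM e A = A e`. -/
theorem planarCLM_apply (e : E³) (A : E³ →L[ℝ] E³) : planarCLM e A = A e := rfl

/-- `combCLM e A = curl A − ⟪e, curl A⟫ e`. -/
theorem combCLM_apply (e : E³) (A : E³ →L[ℝ] E³) : combCLM e A = curlCLM A - ⟪e, curlCLM A⟫ • e := by
  simp [combCLM]

/-- The entries of `strainCLM A` are `⟪A eᵢ, eⱼ⟫ + ⟪eᵢ, A eⱼ⟫`. -/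
theorem strainCLM_apply (A : E³ →L[ℝ] E³) (i j : Fin 3) :
    strainCLM A i j = ⟪A (EuclideanSpace.single i (1 : ℝ)), EuclideanSpace.single j (1 : ℝ)⟫ +
      ⟪EuclideanSpace.single i (1 : ℝ), A (EuclideanSpace.single j (1 : ℝ))⟫ := by
  simp [strainCLM, real_inner_comm]

/-- The rigidity input of the S31 instance is trivial. -/
theorem staticLRigidity_curlCLM : StaticLRigidity (curlCLM : (E³ →L[ℝ] E³) →L[ℝ] E³) := by
  intro V _ _ _ _ hL y hy
  rw [curl_eq_curlCLM]
  exact hL y hy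

/-! ## Part C — compositions (PROVED): the schema from its plates -/

omit [NormedSpace ℝ F] in
/-- Identity-theorem step for any constraint: `L(∇V₀)` analytic on `ℝ³∖{0}` and vanishing on the pocket `B(e,κ)` vanishes
on `ℝ³∖{0}`. -/
theorem LConstraint_spread [NormedSpace ℝ F] (L : (E³ →L[ℝ] E³) →L[ℝ] F) {V₀ : E³ → E³}
    (hV : AnalyticOnNhd ℝ V₀ ({0}ᶜ : Set E³)) {e : E³} (he : ‖e‖ = 1) {κ : ℝ} (hκ : 0 < κ)
    (hpocket : ∀ y ∈ ball e κ, L (fderiv ℝ V₀ y) = 0) : ∀ y : E³, y ≠ 0 → L (fderiv ℝ V₀ y) = 0 := by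
  have hG : AnalyticOnNhd ℝ (fun y => L (fderiv ℝ V₀ y)) ({0}ᶜ : Set E³) := L.comp_analyticOnNhd hV.fderiv
  have he0 : e ∈ ({0}ᶜ : Set E³) := by
    intro h
    have : ‖e‖ = 0 := by rw [mem_singleton_iff.1 h, norm_zero]
    linarith
  have hev : (fun y => L (fderiv ℝ V₀ y)) =ᶠ[𝓝 e] 0 :=
    Filter.eventuallyEq_iff_exists_mem.2 ⟨ball e κ, ball_mem_nhds e hκ, fun y hy => hpocket y hy⟩
  have hz := hG.eqOn_zero_of_preconnected_of_eventuallyEq_zero isPreconnected_compl_zero he0 hev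
  intro y hy
  exact hz (mem_compl_singleton_iff.2 hy)

/-- Top-curl convergence from top-gradient convergence. -/
theorem topCurlTendsto_of_topGradTendsto {Uc : ℝ → E³ → E³} {V₀ : E³ → E³} (h : TopGradTendsto Uc V₀) :
    TopCurlTendsto Uc (curl V₀) := by
  intro x₁ hx₁ θ hθ
  have hK : 0 < ‖(curlCLM : (E³ →L[ℝ] E³) →L[ℝ] E³)‖ + 1 := by positivity
  obtain ⟨s₀, δ, hs₀, hs₁, hδ, hconv⟩ := h x₁ hx₁ (θ / (‖(curlCLM : (E³ →L[ℝ] E³) →L[ℝ] E³)‖ + 1)) (div_pos hθ hK)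
  refine ⟨s₀, δ, hs₀, hs₁, hδ, fun s hs x hx => ?_⟩
  have h2 := (hconv s hs x hx).2
  rw [curl_eq_curlCLM, curl_eq_curlCLM, ← map_sub]
  calc ‖curlCLM (fderiv ℝ (Uc s) x - fderiv ℝ V₀ x)‖
      ≤ ‖(curlCLM : (E³ →L[ℝ] E³) →L[ℝ] E³)‖ * ‖fderiv ℝ (Uc s) x - fderiv ℝ V₀ x‖ := curlCLM.le_opNorm _
    _ ≤ (‖(curlCLM : (E³ →L[ℝ] E³) →L[ℝ] E³)‖ + 1) * (θ / (‖(curlCLM : (E³ →L[ℝ] E³) →L[ℝ] E³)‖ + 1)) := by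
        gcongr
        · linarith
    _ = θ := by field_simp

/-- **COMPOSITION (PV frame): DOOR_L from K1_L, LEG F (velocity, limit level), the static rigidity of `L`, and S31's K2
(tree theorem `tracelessScarLiouville_holds`).** -/
theorem pvLPocketRegularity_of (L : (E³ →L[ℝ] E³) →L[ℝ] F) (hZ : LPocketZoom L) (hF : TerminalTraceAnalyticVelocity)
    (hR : StaticLRigidity L) : PVLPocketRegularity L := by
  intro Cu hCu κ hκ hκ1
  by_contra hdoor
  obtain ⟨w, π, H, C, e, Uc, V₀, hsw, hwg, hI, hapex, he, hsing, hUc, hUcc, hcl, htop, hV, hdV, hdiv, hpocket⟩ :=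
    hZ Cu hCu κ hκ hκ1 hdoor
  -- LEG F: the terminal velocity trace is analytic off the apex; identity theorem; static rigidity
  have hVa : AnalyticOnNhd ℝ V₀ ({0}ᶜ : Set E³) := hF C Uc V₀ hcl htop
  have hLall : ∀ y : E³, y ≠ 0 → L (fderiv ℝ V₀ y) = 0 := LConstraint_spread L hVa he hκ hpocket
  have hcurl0 : ∀ y : E³, y ≠ 0 → curl V₀ y = 0 := hR V₀ hVa ⟨C, hV⟩ hdV hdiv hLall
  -- S31's K2 on the half-space `{⟪x,e⟫ > 0}`
  have hhalf : {x : E³ | 0 < ⟪x, e⟫} ⊆ ({0}ᶜ : Set E³) := by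
    intro x hx h0
    have hx' : (0 : ℝ) < ⟪x, e⟫ := hx
    rw [mem_singleton_iff.1 h0, inner_zero_left] at hx'
    exact lt_irrefl 0 hx'
  have hsub : Ioo (-1 : ℝ) 0 ×ˢ {x : E³ | 0 < ⟪x, e⟫} ⊆ Ioo (-1 : ℝ) 0 ×ˢ ({0}ᶜ : Set E³) :=
    prod_mono Subset.rfl hhalf
  have hUc' : uncurry Uc =ᵐ[volume.restrict (Ioo (-1 : ℝ) 0 ×ˢ {x : E³ | 0 < ⟪x, e⟫})] uncurry w :=
    ae_restrict_of_ae_restrict_of_subset hsub hUc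
  have hUcc' : ContinuousOn (uncurry Uc) (Ioo (-1 : ℝ) 0 ×ˢ {x : E³ | 0 < ⟪x, e⟫}) := hUcc.mono hsub
  have htopc := topCurlTendsto_of_topGradTendsto htop
  have htopc' : ∀ x₁ : E³, 0 < ⟪x₁, e⟫ → ∀ θ : ℝ, 0 < θ → ∃ s₀ δ : ℝ, s₀ < 0 ∧ (-1 : ℝ) ≤ s₀ ∧
      0 < δ ∧ ∀ s ∈ Ioo s₀ 0, ∀ x ∈ ball x₁ δ, ‖curl (Uc s) x‖ ≤ θ := by
    intro x₁ hx₁ θ hθ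
    have hx₁0 : x₁ ≠ 0 := fun h => hhalf hx₁ (mem_singleton_iff.2 h)
    obtain ⟨s₀, δ, hs₀, hs₁, hδ, hconv⟩ := htopc x₁ hx₁0 θ hθ
    have hn : 0 < ‖x₁‖ := norm_pos_iff.2 hx₁0
    refine ⟨s₀, min δ (‖x₁‖ / 2), hs₀, hs₁, lt_min hδ (by linarith), fun s hs x hx => ?_⟩
    have hxδ : x ∈ ball x₁ δ := ball_subset_ball (min_le_left _ _) hx
    have hx0 : x ≠ 0 := by
      intro h0
      rw [h0, mem_ball, dist_zero_left] at hx
      linarith [min_le_right δ (‖x₁‖ / 2)]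
    have h1 := hconv s hs x hxδ
    have h2 : curl V₀ x = 0 := hcurl0 x hx0
    simpa [h2] using h1
  exact tracelessScarLiouville_holds w π H hsw hwg hI C hapex e he Uc hUc' hUcc' htopc' hsing

/-- **COMPOSITION (physical frame).** -/
theorem targetLPocket_of (L : (E³ →L[ℝ] E³) →L[ℝ] F) (hZ : LPocketZoom L) (hF : TerminalTraceAnalyticVelocity)
    (hR : StaticLRigidity L) (hT : FrameTransferL L) : TargetLPocket L :=
  hT (pvLPocketRegularity_of L hZ hF hR)

/-- **THE SCHEMA from its two generic plates** (K1_L for every `L`, LEG F velocity at the limit). -/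
theorem lPocketSchema_of
    (hZ : ∀ (F : Type) [NormedAddCommGroup F] [NormedSpace ℝ F] (L : (E³ →L[ℝ] E³) →L[ℝ] F), LPocketZoom L)
    (hF : TerminalTraceAnalyticVelocity) : LPocketSchema :=
  fun F _ _ L hR => pvLPocketRegularity_of L (hZ F L) hF hR

/-! ## Part D — the three named instances (closed texts for plates and bc7) -/

/-- K2_strain: Killing fields on `ℝ³∖{0}` with decay vanish (M). -/
def StrainRigidity : Prop := StaticLRigidity strainCLM

/-- K2_planar: fields constant along `e`-lines with decay vanish off the axis (S/M). -/
def PlanarRigidity : Prop := ∀ e : E³, ‖e‖ = 1 → StaticLRigidity (planarCLM e)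

/-- K2_comb: a divergence-free analytic vorticity parallel to a constant direction with gradient decay vanishes (S/M). -/
def CombRigidity : Prop := ∀ e : E³, ‖e‖ = 1 → StaticLRigidity (combCLM e)

/-- DOOR «strain-quiet pocket»: a Type-I blow-up strains every pocket at the blow-up time. -/
def TargetStrainPocket : Prop := TargetLPocket strainCLM

/-- DOOR «planar pocket»: a Type-I blow-up is nowhere locally 2D at the blow-up time. -/
def TargetPlanarPocket : Prop := ∀ e : E³, ‖e‖ = 1 → TargetLPocket (planarCLM e)

/-- DOOR «combed pocket»: a Type-I blow-up twists the vorticity direction in every pocket at the blow-up time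
(contains S31: a quiet pocket is combed along every `e`). -/
def TargetCombedPocket : Prop := ∀ e : E³, ‖e‖ = 1 → TargetLPocket (combCLM e)

/-- Closer of the «strain-quiet pocket» door from its plates. -/
theorem targetStrainPocket_of (hZ : LPocketZoom strainCLM) (hF : TerminalTraceAnalyticVelocity) (hR : StrainRigidity)
    (hT : FrameTransferL strainCLM) : TargetStrainPocket :=
  targetLPocket_of strainCLM hZ hF hR hT

/-- Closer of the «planar pocket» door from its plates. -/
theorem targetPlanarPocket_of (hZ : ∀ e : E³, ‖e‖ = 1 → LPocketZoom (planarCLM e)) (hF : TerminalTraceAnalyticVelocity)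
    (hR : PlanarRigidity) (hT : ∀ e : E³, ‖e‖ = 1 → FrameTransferL (planarCLM e)) : TargetPlanarPocket :=
  fun e he => targetLPocket_of (planarCLM e) (hZ e he) hF (hR e he) (hT e he)

/-- Closer of the «combed pocket» door from its plates. -/
theorem targetCombedPocket_of (hZ : ∀ e : E³, ‖e‖ = 1 → LPocketZoom (combCLM e)) (hF : TerminalTraceAnalyticVelocity)
    (hR : CombRigidity) (hT : ∀ e : E³, ‖e‖ = 1 → FrameTransferL (combCLM e)) : TargetCombedPocket :=
  fun e he => targetLPocket_of (combCLM e) (hZ e he) hF (hR e he) (hT e he)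

/-- S31 ⊂ «combed»: a pocket quiet for the curl is combed along every unit `e` (pointwise, same `ε`). -/
theorem norm_combCLM_le (e : E³) (he : ‖e‖ = 1) (A : E³ →L[ℝ] E³) : ‖combCLM e A‖ ≤ 2 * ‖curlCLM A‖ := by
  rw [combCLM_apply]
  calc ‖curlCLM A - ⟪e, curlCLM A⟫ • e‖ ≤ ‖curlCLM A‖ + ‖⟪e, curlCLM A⟫ • e‖ := norm_sub_le _ _
    _ ≤ ‖curlCLM A‖ + ‖curlCLM A‖ := by
        gcongr
        rw [norm_smul, he, mul_one, Real.norm_eq_abs]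
        calc |⟪e, curlCLM A⟫| ≤ ‖e‖ * ‖curlCLM A‖ := abs_real_inner_le_norm _ _
          _ = ‖curlCLM A‖ := by rw [he, one_mul]
    _ = 2 * ‖curlCLM A‖ := by ring

end Summit.NavierStokesRegularity.NavierStokesRegularity.Theorems.QuietScarPocketDoor
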